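import Literature.Analysis.FluidPDE.LocalTypeI
import HarnessLib

/-!
# The REGULARITY-RADIUS DICHOTOMY at the top time (stub Z3 `stub_radiusDichotomy` of the candidate line
# `radius_dichotomy` for item `TerminalTrace.TypeITraceScarL3`, stmt-NavierStokesRegularity-18385) — pure analysis

Seat nsreg-C26-p1 g5 (cell ns-regularity-ideate), `--supports stmt-NavierStokesRegularity-18385` (helper); memo
`HOME/nsreg-C26-p1-LOUD-ZOOM-18385.md`, candidate skeleton `Cruxes/TypeITraceScarL3/Lines/radius_dichotomy_CANDIDATE.lean`.

For an ARBITRARY field `U : ℝ → ℝ³ → ℝ³` (no equation) call a radius `r > 0` ADMISSIBLE at a top point `y` if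
`‖U‖ ≤ r⁻¹` a.e. on the backward parabolic ball `Q_r(0, y)` — the scale-invariant `L^∞` regularity radius. Let `Σ₀`
be the set of backward-singular top points. Then EITHER

* (CASE 2) the admissible radius is comparable to the distance to `Σ₀`: there is `c₀ > 0` such that every
  `r ≤ c₀ · min(dist(y, Σ₀), 1)` is admissible at every backward-regular top point `y`, OR
* (CASE 1) at every magnification `A > 0` there are a point `ȳ` and a radius `0 < r ≤ 1/2` such that `r/4` is admissible at
  every point of `B(ȳ, A r)` while `2r` is NOT admissible at `ȳ`.

Proof (no PDE): admissibility is monotone under `Q_{r'}(0,y') ⊆ Q_r(0,y)` (`dist y' y + r' ≤ r`); every backward-regular top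
point carries a positive admissible radius uniformly on a neighbourhood (the essential supremum on one parabolic ball); if
CASE 2 fails with constant `1/(16A)` at a regular `y`, `d = dist(y, Σ₀) > 0`, then the closed ball `B̄(y, d/2)` consists of
regular points and, by compactness, carries a uniform admissible radius; the DYADIC radius
`ρ(y') = max{2^{-j} admissible at y', j ≥ 2}` is then well defined there, and a near-minimiser `ȳ` (factor `3/2`) of
`Φ(y') = ρ(y')/(d/2 − dist(y', y))` over the open ball `B(y, d/2)` does it with `r = ρ(ȳ)`: `r < 1/8`, so `2r` is a
non-admissible dyadic radius; and for `y' ∈ B(ȳ, A r)` one gets `dist(y', ȳ) < (3/16)(d/2 − dist(ȳ, y))`, whence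
`ρ(y') > (13/24) r > r/2`, i.e. `ρ(y') ≥ r` (dyadic), so `r` (a fortiori `r/4`) is admissible at `y'`.
WHAT THIS IS NOT: nothing about Navier–Stokes; 18385 / NS regularity NOT proved. [folklore]
-/

noncomputable section

set_option linter.dupNamespace false

namespace Summit.NavierStokesRegularity.NavierStokesRegularity.Theorems.TypeITraceScarL3

open MeasureTheory Set Function Filter Topology Metric
open Literature.Analysis.FluidPDE
open scoped NNReal ENNReal

/-! ### Parabolic balls hanging from top points -/

/-- `Q_{r'}(0, y') ⊆ Q_r(0, y)` as soon as `dist y' y + r' ≤ r` (`r' ≥ 0`). [folklore] -/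
theorem parabolicCylinder_top_subset {y y' : EuclideanSpace ℝ (Fin 3)} {r r' : ℝ} (hr' : 0 ≤ r')
    (h : dist y' y + r' ≤ r) :
    parabolicCylinder r' (((0 : ℝ), y') : ℝ × EuclideanSpace ℝ (Fin 3)) ⊆
      parabolicCylinder r (((0 : ℝ), y) : ℝ × EuclideanSpace ℝ (Fin 3)) := by
  intro w hw
  rw [mem_parabolicCylinder] at hw ⊢
  dsimp only at hw ⊢
  have hrr : r' ≤ r := by linarith [dist_nonneg (x := y') (y := y)]
  have hsq : r' ^ 2 ≤ r ^ 2 := pow_le_pow_left₀ hr' hrr 2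
  refine ⟨⟨by linarith [hw.1.1], hw.1.2⟩, ?_⟩
  calc dist w.2 y ≤ dist w.2 y' + dist y' y := dist_triangle _ _ _
    _ < r' + dist y' y := by linarith [hw.2]
    _ ≤ r := by linarith

/-- Admissibility is monotone: if `‖U‖ ≤ r⁻¹` a.e. on `Q_r(0,y)` and `dist y' y + r' ≤ r`, `r' > 0`, then `‖U‖ ≤ r'⁻¹`
a.e. on `Q_{r'}(0,y')`. [folklore] -/
theorem topAdmissible_mono {U : ℝ → EuclideanSpace ℝ (Fin 3) → EuclideanSpace ℝ (Fin 3)}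
    {y y' : EuclideanSpace ℝ (Fin 3)} {r r' : ℝ} (hr' : 0 < r') (h : dist y' y + r' ≤ r)
    (hA : ∀ᵐ z ∂(volume.restrict (parabolicCylinder r (((0 : ℝ), y) : ℝ × EuclideanSpace ℝ (Fin 3)))),
      ‖U z.1 z.2‖ ≤ r⁻¹) :
    ∀ᵐ z ∂(volume.restrict (parabolicCylinder r' (((0 : ℝ), y') : ℝ × EuclideanSpace ℝ (Fin 3)))),
      ‖U z.1 z.2‖ ≤ r'⁻¹ := by
  have hrr : r' ≤ r := by linarith [dist_nonneg (x := y') (y := y)]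
  filter_upwards [ae_restrict_of_ae_restrict_of_subset (parabolicCylinder_top_subset hr'.le h) hA] with z hz
  exact hz.trans (inv_anti₀ hr' hrr)

/-- Same centre: if `r` is admissible at `y` then so is every `0 < r' ≤ r`. [folklore] -/
theorem topAdmissible_of_le {U : ℝ → EuclideanSpace ℝ (Fin 3) → EuclideanSpace ℝ (Fin 3)}
    {y : EuclideanSpace ℝ (Fin 3)} {r r' : ℝ} (hr' : 0 < r') (h : r' ≤ r)
    (hA : ∀ᵐ z ∂(volume.restrict (parabolicCylinder r (((0 : ℝ), y) : ℝ × EuclideanSpace ℝ (Fin 3)))),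
      ‖U z.1 z.2‖ ≤ r⁻¹) :
    ∀ᵐ z ∂(volume.restrict (parabolicCylinder r' (((0 : ℝ), y) : ℝ × EuclideanSpace ℝ (Fin 3)))),
      ‖U z.1 z.2‖ ≤ r'⁻¹ :=
  topAdmissible_mono hr' (by rw [dist_self]; linarith) hA

/-- **Every backward-regular top point carries a positive admissible radius, uniformly on a neighbourhood**: if
`(0, y)` is not a backward-singular point of `U`, there are `r₀ > 0` and `0 < r₁ ≤ 1/4` with `‖U‖ ≤ r₁⁻¹` a.e. on
`Q_{r₁}(0, y')` for every `y' ∈ B(y, r₀)` (the essential supremum `K` of `U` on one parabolic ball `Q_r(0,y)`,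
`r₀ = r/2`, `r₁ = min(r/2, 1/4, 1/(K+1))`). [folklore] -/
theorem exists_topAdmissible_near_of_not_isBackwardSingularPoint
    {U : ℝ → EuclideanSpace ℝ (Fin 3) → EuclideanSpace ℝ (Fin 3)} {y : EuclideanSpace ℝ (Fin 3)}
    (hy : ¬ IsBackwardSingularPoint U (((0 : ℝ), y) : ℝ × EuclideanSpace ℝ (Fin 3))) :
    ∃ r₀ : ℝ, 0 < r₀ ∧ ∃ r₁ : ℝ, 0 < r₁ ∧ r₁ ≤ 1 / 4 ∧ ∀ y' ∈ ball y r₀,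
      ∀ᵐ z ∂(volume.restrict (parabolicCylinder r₁ (((0 : ℝ), y') : ℝ × EuclideanSpace ℝ (Fin 3)))),
        ‖U z.1 z.2‖ ≤ r₁⁻¹ := by
  simp only [IsBackwardSingularPoint, not_forall] at hy
  obtain ⟨r, hr, hne⟩ := hy
  set μ : Measure (ℝ × EuclideanSpace ℝ (Fin 3)) :=
    volume.restrict (parabolicCylinder r (((0 : ℝ), y) : ℝ × EuclideanSpace ℝ (Fin 3))) with hμ
  set K : ℝ := (eLpNorm (uncurry U) ⊤ μ).toReal with hK
  have hK0 : 0 ≤ K := ENNReal.toReal_nonneg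
  have hKae : ∀ᵐ z ∂μ, ‖U z.1 z.2‖ ≤ K := by
    have h1 : ∀ᵐ z ∂μ, ‖uncurry U z‖ₑ ≤ eLpNorm (uncurry U) ⊤ μ := by
      rw [eLpNorm_exponent_top]
      exact ae_le_eLpNormEssSup
    filter_upwards [h1] with z hz
    have h2 := ENNReal.toReal_mono hne hz
    rwa [← ofReal_norm, ENNReal.toReal_ofReal (norm_nonneg _)] at h2
  set r₁ : ℝ := min (r / 2) (min (1 / 4) (1 / (K + 1))) with hr₁
  have hr₁pos : 0 < r₁ := lt_min (by positivity) (lt_min (by norm_num) (by positivity))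
  have hr₁r : r₁ ≤ r / 2 := min_le_left _ _
  have hr₁4 : r₁ ≤ 1 / 4 := (min_le_right _ _).trans (min_le_left _ _)
  have hr₁K : r₁ ≤ 1 / (K + 1) := (min_le_right _ _).trans (min_le_right _ _)
  refine ⟨r / 2, by positivity, r₁, hr₁pos, hr₁4, fun y' hy' => ?_⟩
  rw [mem_ball] at hy'
  have hsub : parabolicCylinder r₁ (((0 : ℝ), y') : ℝ × EuclideanSpace ℝ (Fin 3)) ⊆
      parabolicCylinder r (((0 : ℝ), y) : ℝ × EuclideanSpace ℝ (Fin 3)) :=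
    parabolicCylinder_top_subset hr₁pos.le (by linarith)
  filter_upwards [ae_restrict_of_ae_restrict_of_subset hsub hKae] with z hz
  have hK1 : K + 1 ≤ r₁⁻¹ := by
    have h := inv_anti₀ hr₁pos hr₁K
    rwa [one_div, inv_inv] at h
  linarith

/-- Powers of `1/2` compare like their exponents, reversed: `(1/2)^i > (1/2)^(j+1)` forces `i ≤ j`. [folklore] -/
theorem le_of_half_pow_lt_half_pow {i j : ℕ} (h : (1 / 2 : ℝ) ^ (j + 1) < (1 / 2 : ℝ) ^ i) : i ≤ j := by
  by_contra hij
  have hle : j + 1 ≤ i := by omega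
  have := pow_le_pow_of_le_one (by norm_num : (0 : ℝ) ≤ 1 / 2) (by norm_num) hle
  linarith

set_option maxHeartbeats 800000 in
/-- **The regularity-radius dichotomy at the top time** (stub Z3 `stub_radiusDichotomy` of the candidate line
`radius_dichotomy`, statement VERBATIM): see the module docstring. [folklore] -/
theorem radiusDichotomy :
    ∀ (U : ℝ → EuclideanSpace ℝ (Fin 3) → EuclideanSpace ℝ (Fin 3)),
    (∃ c₀ : ℝ, 0 < c₀ ∧ ∀ y : EuclideanSpace ℝ (Fin 3),
        ¬ IsBackwardSingularPoint U ((0 : ℝ), y) →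
        ∀ r : ℝ, 0 < r →
          r ≤ c₀ * min (infDist y {x : EuclideanSpace ℝ (Fin 3) | IsBackwardSingularPoint U ((0 : ℝ), x)}) 1 →
          ∀ᵐ z ∂(volume.restrict (parabolicCylinder r (((0 : ℝ), y) : ℝ × EuclideanSpace ℝ (Fin 3)))),
            ‖U z.1 z.2‖ ≤ r⁻¹) ∨
    (∀ A : ℝ, 0 < A → ∃ (yc : EuclideanSpace ℝ (Fin 3)) (r : ℝ), 0 < r ∧ r ≤ 1 / 2 ∧
        (∀ y' ∈ ball yc (A * r),
          ∀ᵐ z ∂(volume.restrict (parabolicCylinder (r / 4) (((0 : ℝ), y') : ℝ × EuclideanSpace ℝ (Fin 3)))),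
            ‖U z.1 z.2‖ ≤ (r / 4)⁻¹) ∧
        ¬ (∀ᵐ z ∂(volume.restrict (parabolicCylinder (2 * r) (((0 : ℝ), yc) : ℝ × EuclideanSpace ℝ (Fin 3)))),
            ‖U z.1 z.2‖ ≤ (2 * r)⁻¹)) := by
  classical
  intro U
  rw [or_iff_not_imp_left]
  intro hnot A hA
  -- enlarge the magnification to `A' ≥ 1`
  set A' : ℝ := max A 1 with hA'
  have hA'1 : 1 ≤ A' := le_max_right _ _
  have hAA' : A ≤ A' := le_max_left _ _
  have hA'pos : 0 < A' := one_pos.trans_le hA'1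
  simp only [not_exists, not_and, not_forall, exists_prop] at hnot
  obtain ⟨y, hyreg, rb, hrb, hrble, hnadm⟩ := hnot (1 / (16 * A')) (by positivity)
  set S : Set (EuclideanSpace ℝ (Fin 3)) :=
    {x : EuclideanSpace ℝ (Fin 3) | IsBackwardSingularPoint U ((0 : ℝ), x)} with hS
  set d : ℝ := infDist y S with hd
  -- `d > 0`
  have hc₀pos : 0 < 1 / (16 * A') := by positivity
  have hmin_pos : 0 < min d 1 := by
    by_contra h
    simp only [not_lt] at h
    have h2 : 1 / (16 * A') * min d 1 ≤ 0 := mul_nonpos_of_nonneg_of_nonpos hc₀pos.le h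
    linarith
  have hdpos : 0 < d := lt_min_iff.1 hmin_pos |>.1
  have hmin_le_d : min d 1 ≤ d := min_le_left _ _
  have hmin_le_1 : min d 1 ≤ 1 := min_le_right _ _
  -- every point of the closed ball `B̄(y, d/2)` is backward-regular
  have hreg : ∀ y' ∈ closedBall y (d / 2), ¬ IsBackwardSingularPoint U ((0 : ℝ), y') := by
    intro y' hy' hsing
    have h1 : infDist y S ≤ dist y y' := infDist_le_dist_of_mem (by exact hsing)
    rw [mem_closedBall, dist_comm] at hy'
    linarith
  -- a uniform admissible radius on the closed ball (compactness)
  have hunif : ∃ r₁ : ℝ, 0 < r₁ ∧ r₁ ≤ 1 / 4 ∧ ∀ y' ∈ closedBall y (d / 2),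
      ∀ᵐ z ∂(volume.restrict (parabolicCylinder r₁ (((0 : ℝ), y') : ℝ × EuclideanSpace ℝ (Fin 3)))),
        ‖U z.1 z.2‖ ≤ r₁⁻¹ := by
    choose! r₀ hr₀ r₁ hr₁ hr₁4 hadm using
      fun (y' : EuclideanSpace ℝ (Fin 3)) (hy' : y' ∈ closedBall y (d / 2)) =>
        exists_topAdmissible_near_of_not_isBackwardSingularPoint (hreg y' hy')
    have hcov : closedBall y (d / 2) ⊆ ⋃ i ∈ closedBall y (d / 2), ball i (r₀ i) :=
      fun y' hy' => mem_iUnion₂.2 ⟨y', hy', mem_ball_self (hr₀ y' hy')⟩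
    obtain ⟨b, hbK, hbfin, hbcov⟩ := (isCompact_closedBall y (d / 2)).elim_finite_subcover_image
      (fun i _ => isOpen_ball) hcov
    have hbne : b.Nonempty := by
      have hy0 : y ∈ closedBall y (d / 2) := mem_closedBall_self (by positivity)
      obtain ⟨i, hi, -⟩ := mem_iUnion₂.1 (hbcov hy0)
      exact ⟨i, hi⟩
    obtain ⟨i₀, hi₀, hmin⟩ := Set.exists_min_image b r₁ hbfin hbne
    refine ⟨r₁ i₀, hr₁ i₀ (hbK hi₀), hr₁4 i₀ (hbK hi₀), fun y' hy' => ?_⟩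
    obtain ⟨i, hi, hyi⟩ := mem_iUnion₂.1 (hbcov hy')
    exact topAdmissible_of_le (hr₁ i₀ (hbK hi₀)) (hmin i hi) (hadm i (hbK hi) y' hyi)
  obtain ⟨r₁, hr₁, hr₁4, hadm₁⟩ := hunif
  -- the dyadic radius `ρ = (1/2)^j`, `j ≥ 2` minimal admissible, on the closed ball
  obtain ⟨j₁, hj₁⟩ : ∃ j₁ : ℕ, (1 / 2 : ℝ) ^ j₁ ≤ r₁ :=
    exists_pow_lt_of_lt_one hr₁ (by norm_num : (1 / 2 : ℝ) < 1) |>.imp fun _ h => h.le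
  have hP : ∀ y' ∈ closedBall y (d / 2), ∃ j : ℕ, 2 ≤ j ∧
      ∀ᵐ z ∂(volume.restrict (parabolicCylinder ((1 / 2 : ℝ) ^ j) (((0 : ℝ), y') : ℝ × EuclideanSpace ℝ (Fin 3)))),
        ‖U z.1 z.2‖ ≤ ((1 / 2 : ℝ) ^ j)⁻¹ := by
    intro y' hy'
    refine ⟨max j₁ 2, le_max_right _ _, topAdmissible_of_le (by positivity) ?_ (hadm₁ y' hy')⟩
    exact (pow_le_pow_of_le_one (by norm_num) (by norm_num) (le_max_left j₁ 2)).trans hj₁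
  -- the index function (junk `0` off the closed ball)
  set jf : EuclideanSpace ℝ (Fin 3) → ℕ := fun y' =>
    if h : y' ∈ closedBall y (d / 2) then Nat.find (hP y' h) else 0 with hjf
  set ρ : EuclideanSpace ℝ (Fin 3) → ℝ := fun y' => (1 / 2 : ℝ) ^ (jf y') with hρ
  have hρpos : ∀ y', 0 < ρ y' := fun y' => by positivity
  have hρspec : ∀ y' ∈ closedBall y (d / 2), 2 ≤ jf y' ∧
      ∀ᵐ z ∂(volume.restrict (parabolicCylinder (ρ y') (((0 : ℝ), y') : ℝ × EuclideanSpace ℝ (Fin 3)))),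
        ‖U z.1 z.2‖ ≤ (ρ y')⁻¹ := by
    intro y' hy'
    have hj : jf y' = Nat.find (hP y' hy') := by rw [hjf]; exact dif_pos hy'
    have hs := Nat.find_spec (hP y' hy')
    rw [← hj] at hs
    exact hs
  have hρmin : ∀ y' ∈ closedBall y (d / 2), ∀ j : ℕ, 2 ≤ j →
      (∀ᵐ z ∂(volume.restrict (parabolicCylinder ((1 / 2 : ℝ) ^ j) (((0 : ℝ), y') : ℝ × EuclideanSpace ℝ (Fin 3)))),
        ‖U z.1 z.2‖ ≤ ((1 / 2 : ℝ) ^ j)⁻¹) → jf y' ≤ j := by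
    intro y' hy' j hj hadmj
    have hj' : jf y' = Nat.find (hP y' hy') := by rw [hjf]; exact dif_pos hy'
    rw [hj']
    exact Nat.find_min' (hP y' hy') ⟨hj, hadmj⟩
  have hρlow : ∀ y' ∈ closedBall y (d / 2), (1 / 2 : ℝ) ^ (max j₁ 2) ≤ ρ y' := by
    intro y' hy'
    have hle : jf y' ≤ max j₁ 2 := hρmin y' hy' (max j₁ 2) (le_max_right _ _)
      (topAdmissible_of_le (by positivity)
        ((pow_le_pow_of_le_one (by norm_num) (by norm_num) (le_max_left j₁ 2)).trans hj₁) (hadm₁ y' hy'))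
    exact pow_le_pow_of_le_one (by norm_num) (by norm_num) hle
  -- `ρ(y) < rb`: otherwise `rb` would be admissible at `y`
  have hy0 : y ∈ closedBall y (d / 2) := mem_closedBall_self (by positivity)
  have hρy : ρ y < rb := by
    by_contra h
    simp only [not_lt] at h
    exact hnadm (topAdmissible_of_le hrb h (hρspec y hy0).2)
  -- `16 A' rb ≤ min(d,1)`, hence `rb ≤ 1/16` and `A' rb ≤ d/16`
  have hc₀A : A' * (1 / (16 * A')) = 1 / 16 := by field_simp
  have hrb16 : 16 * (A' * rb) ≤ min d 1 := by nlinarith [hrble, hc₀A, hA'pos]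
  have hrb1 : rb ≤ 1 / 16 := by nlinarith [hrb16, hmin_le_1, hA'1, hrb]
  have hArb : A' * rb ≤ d / 16 := by linarith [hrb16, hmin_le_d]
  -- the weight and the functional `Φ = ρ / w` on the open ball
  set w : EuclideanSpace ℝ (Fin 3) → ℝ := fun y' => d / 2 - dist y' y with hw
  set Φ : EuclideanSpace ℝ (Fin 3) → ℝ := fun y' => ρ y' / w y' with hΦ
  have hwpos : ∀ y' ∈ ball y (d / 2), 0 < w y' := fun y' hy' => by
    rw [mem_ball] at hy'; show 0 < d / 2 - dist y' y; linarith
  have hwle : ∀ y', w y' ≤ d / 2 := fun y' => by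
    show d / 2 - dist y' y ≤ d / 2; linarith [dist_nonneg (x := y') (y := y)]
  set m : ℝ := (1 / 2 : ℝ) ^ (max j₁ 2) / (d / 2) with hm
  have hmpos : 0 < m := by positivity
  have hΦlow : ∀ y' ∈ ball y (d / 2), m ≤ Φ y' := by
    intro y' hy'
    have h1 := hρlow y' (ball_subset_closedBall hy')
    show (1 / 2 : ℝ) ^ (max j₁ 2) / (d / 2) ≤ ρ y' / w y'
    exact div_le_div₀ (hρpos y').le h1 (hwpos y' hy') (hwle y')
  -- the infimum `m₀` of `Φ` over the open ball and a near-minimiser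
  set T : Set ℝ := Φ '' ball y (d / 2) with hT
  have hTne : T.Nonempty := ⟨Φ y, y, mem_ball_self (by positivity), rfl⟩
  have hTbdd : BddBelow T := ⟨m, by rintro _ ⟨y', hy', rfl⟩; exact hΦlow y' hy'⟩
  set m₀ : ℝ := sInf T with hm₀
  have hm₀low : m ≤ m₀ := le_csInf hTne (by rintro _ ⟨y', hy', rfl⟩; exact hΦlow y' hy')
  have hm₀pos : 0 < m₀ := hmpos.trans_le hm₀low
  have hm₀le : ∀ y' ∈ ball y (d / 2), m₀ ≤ Φ y' := fun y' hy' => csInf_le hTbdd ⟨y', hy', rfl⟩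
  obtain ⟨_, ⟨yc, hyc, rfl⟩, hΦyc⟩ := exists_lt_of_csInf_lt hTne (by linarith : m₀ < 3 / 2 * m₀)
  -- `Φ(y) · (d/2) = ρ(y) < rb`
  have hwy : w y = d / 2 := by show d / 2 - dist y y = d / 2; rw [dist_self, sub_zero]
  have hΦy : Φ y * (d / 2) = ρ y := by
    show ρ y / w y * (d / 2) = ρ y
    rw [hwy]; field_simp
  have hΦy0 : 0 ≤ Φ y := div_nonneg (hρpos y).le (by rw [hwy]; positivity)
  have hAΦ : A' * Φ y < 1 / 8 := by
    have h1 : A' * Φ y * (d / 2) < 1 / 8 * (d / 2) := by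
      rw [mul_assoc, hΦy]; nlinarith [hρy, hArb, hA'pos]
    exact lt_of_mul_lt_mul_right h1 (by positivity)
  have hΦy1 : Φ y * (d / 2) < 1 / 16 := by rw [hΦy]; linarith
  have hm₀y : m₀ ≤ Φ y := hm₀le y (mem_ball_self (by positivity))
  -- the radius
  set r : ℝ := ρ yc with hr
  have hrpos : 0 < r := hρpos yc
  have hwc : 0 < w yc := hwpos yc hyc
  have hrΦ : r = Φ yc * w yc := by
    show ρ yc = ρ yc / w yc * w yc; field_simp
  have hycK : yc ∈ closedBall y (d / 2) := ball_subset_closedBall hyc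
  -- `m₀ w_c > (2/3) r` and `r < (3/2) Φ(y) w_c`
  have hkey1 : 2 / 3 * r < m₀ * w yc := by
    rw [hrΦ]; nlinarith [hΦyc, hwc]
  have hΦyc' : Φ yc < 3 / 2 * Φ y := by nlinarith [hΦyc, hm₀y]
  -- `r < 3/32 < 1/8` (so `2r` is a dyadic radius `≤ (1/2)^2` that is not admissible) and `r ≤ 1/2`
  have hr_small : r < 3 / 32 := by
    rw [hrΦ]
    have h1 : Φ yc * w yc ≤ Φ yc * (d / 2) :=
      mul_le_mul_of_nonneg_left (hwle yc) (div_nonneg (hρpos yc).le hwc.le)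
    have h2 : Φ yc * (d / 2) < 3 / 2 * (Φ y * (d / 2)) := by nlinarith [hΦyc', hdpos]
    linarith
  have hjc3 : 3 ≤ jf yc := by
    by_contra h
    have hle : jf yc ≤ 2 := by omega
    have : (1 / 2 : ℝ) ^ 2 ≤ (1 / 2 : ℝ) ^ (jf yc) :=
      pow_le_pow_of_le_one (by norm_num) (by norm_num) hle
    have h4 : (1 / 2 : ℝ) ^ (jf yc) = r := rfl
    rw [h4] at this
    norm_num at this
    linarith
  refine ⟨yc, r, hrpos, by linarith, fun y' hy' => ?_, fun hadm2 => ?_⟩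
  · -- neighbours: `dist y' yc < A r ≤ A' r < (3/16) w_c`
    rw [mem_ball] at hy'
    have hd1 : dist y' yc < 3 / 16 * w yc := by
      have h1 : A * r ≤ A' * r := mul_le_mul_of_nonneg_right hAA' hrpos.le
      have h2 : A' * r < A' * (3 / 2 * Φ y * w yc) := by
        refine mul_lt_mul_of_pos_left ?_ hA'pos
        rw [hrΦ]; nlinarith [hΦyc', hwc]
      have h3 : A' * (3 / 2 * Φ y * w yc) = 3 / 2 * (A' * Φ y) * w yc := by ring
      have h4 : 3 / 2 * (A' * Φ y) * w yc < 3 / 2 * (1 / 8) * w yc := by nlinarith [hAΦ, hwc]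
      linarith
    have hw' : 13 / 16 * w yc < w y' := by
      show 13 / 16 * w yc < d / 2 - dist y' y
      have : dist y' y ≤ dist y' yc + dist yc y := dist_triangle _ _ _
      have hwc' : w yc = d / 2 - dist yc y := rfl
      linarith
    have hy'B : y' ∈ ball y (d / 2) := by
      rw [mem_ball]
      have : 0 < w y' := by linarith
      show dist y' y < d / 2; linarith [show w y' = d / 2 - dist y' y from rfl]
    have hy'K : y' ∈ closedBall y (d / 2) := ball_subset_closedBall hy'B
    -- `ρ(y') ≥ m₀ w(y') > (13/16) m₀ w_c > (13/24) r > r/2`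
    have hρy' : r / 2 < ρ y' := by
      have h1 : m₀ * w y' ≤ ρ y' := by
        have := hm₀le y' hy'B
        have hw'pos : 0 < w y' := hwpos y' hy'B
        have : m₀ ≤ ρ y' / w y' := this
        rwa [le_div_iff₀ hw'pos] at this
      nlinarith [hkey1, hw', hm₀pos, hwc]
    -- dyadic comparison: `ρ(y') ≥ r`
    have hjle : jf y' ≤ jf yc := by
      refine le_of_half_pow_lt_half_pow ?_
      have : (1 / 2 : ℝ) ^ (jf yc + 1) = r / 2 := by rw [pow_succ]; show (1 / 2 : ℝ) ^ (jf yc) * (1 / 2) = ρ yc / 2; ring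
      rw [this]
      exact hρy'
    have hρge : r ≤ ρ y' := pow_le_pow_of_le_one (by norm_num) (by norm_num) hjle
    have hadm' := topAdmissible_of_le hrpos hρge (hρspec y' hy'K).2
    exact topAdmissible_of_le (by positivity) (by linarith) hadm'
  · -- `2r = (1/2)^(j_c - 1)` with `j_c - 1 ≥ 2` is not admissible at `yc` by minimality
    have hj1 : 2 ≤ jf yc - 1 := by omega
    have h2r : (1 / 2 : ℝ) ^ (jf yc - 1) = 2 * r := by
      have : jf yc = (jf yc - 1) + 1 := by omega
      have h := congrArg (fun n : ℕ => (1 / 2 : ℝ) ^ n) this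
      simp only [pow_succ] at h
      show (1 / 2 : ℝ) ^ (jf yc - 1) = 2 * (1 / 2 : ℝ) ^ (jf yc)
      rw [h]; ring
    have hle := hρmin yc hycK (jf yc - 1) hj1 (by rw [h2r]; exact hadm2)
    omega

end Summit.NavierStokesRegularity.NavierStokesRegularity.Theorems.TypeITraceScarL3

end
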